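import Mathlib
import HarnessLib
import Summits.Ventures.LatticeQCDFlow.Scoring.SU3ConjugacyByTrace
import Summits.Ventures.LatticeQCDFlow.Scoring.SU3TraceDeltoid

/-!
# Real-trace elements of `SU(3)` are the conjugates of `diag(1, e^{iθ}, e^{−iθ})`, `θ ∈ [0, π]` unique: the one-parameter family behind "conjugate to its inverse" / "fixes a vector"

HONEST FRAMING: exact (Metropolis-corrected) sampling algorithms for lattice gauge theory;
figures of merit are autocorrelation/cost numbers at stated couplings and volumes; no
continuum-physics claim.

Venture `LatticeQCDFlow` (cell pub-lqcd), sub-topic `Scoring`; FANOUT row 21 (`su3-base`: the 4D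
`SU(3)` baselines).  NEW WORK of the cell (placement rule), elementary, joining two of row 21's
GEN-8 files: `Scoring/SU3ConjugacyByTrace` (`su3_isConj_iff_trace_eq`: the trace decides the class;
`su3_isConj_inv_iff_im_trace_eq_zero`) and `Scoring/SU3TraceDeltoid`
(`su3_neg_one_le_re_trace_of_im_eq_zero`: a real trace is `≥ −1`).  No definition is introduced;
nothing is cited as a fact; no number of ours.

The real segment `[−1, 3]` of the deltoid is swept exactly once by the torus curve
`θ ↦ D_θ = diag(1, e^{iθ}, e^{−iθ})`, `θ ∈ [0, π]`, whose trace is `1 + 2 cos θ`.  Hence an `SU(3)`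
matrix with REAL trace — equivalently (GEN-8 #3) one conjugate to its inverse, equivalently
(GEN-8 `SU3RealTraceFixedVector`) one fixing a non-zero vector — is conjugate in `SU(3)` to `D_θ` for a
UNIQUE `θ ∈ [0, π]`, namely `θ = arccos((tr U − 1)/2)`: it is a "rotation by `θ`" in a complex
2-plane, fixing the complementary line.  The endpoints are the identity (`θ = 0`, `t = 3`) and the
class of `diag(1, −1, −1)` (`θ = π`, `t = −1`).

## What is proved

* `torusRep_mem` — `diag(1, e^{iθ}, e^{−iθ}) ∈ SU(3)`; `trace_torusRep` — its trace is `1 + 2cos θ`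
  (a real number); `im_trace_torusRep` (`= 0`), `re_trace_torusRep`.
* **`su3_exists_isConj_torusRep_of_im_trace_eq_zero`** — `Im tr U = 0 ⟹ ∃ θ ∈ [0, π]`,
  `U ∼ diag(1, e^{iθ}, e^{−iθ})`, with `θ = arccos((Re tr U − 1)/2)`;
* **`su3_torusRep_angle_unique`** — if `U ∼ D_θ` and `U ∼ D_θ'` with `θ, θ' ∈ [0, π]` then
  `θ = θ'` (`cos` is injective on `[0, π]`);
* `su3_isConj_torusRep_iff` — for `θ ∈ [0, π]`: `U ∼ D_θ ⟺ Im tr U = 0 ∧ Re tr U = 1 + 2cos θ`.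

NOT CLAIMED: an explicit conjugating matrix; the Haar-measure weight of these classes; anything for
`N ≠ 3`.
-/

namespace Summit.Ventures.LatticeQCDFlow.Scoring

open Matrix Complex
open Literature.MathematicalPhysics.QuantumLattice

section SpecialUnitaryThree

/-- The torus representative `diag(1, e^{iθ}, e^{−iθ})` lies in `SU(3)`. -/
theorem torusRep_mem (θ : ℝ) :
    Matrix.diagonal (![1, Complex.exp ((θ : ℂ) * Complex.I), Complex.exp (-((θ : ℂ) * Complex.I))] :
      Fin 3 → ℂ) ∈ Matrix.specialUnitaryGroup (Fin 3) ℂ := by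
  rw [diagonal_mem_specialUnitaryGroup_iff]
  refine ⟨fun i => ?_, ?_⟩
  · fin_cases i
    · simp
    · exact Complex.norm_exp_ofReal_mul_I θ
    · simp only [Fin.reduceFinMk, Matrix.cons_val]
      rw [show -((θ : ℂ) * Complex.I) = ((-θ : ℝ) : ℂ) * Complex.I by push_cast; ring]
      exact Complex.norm_exp_ofReal_mul_I (-θ)
  · rw [Fin.prod_univ_three]
    simp only [Matrix.cons_val_zero, Matrix.cons_val_one, Matrix.cons_val, one_mul]
    rw [← Complex.exp_add, add_neg_cancel, Complex.exp_zero]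

/-- The trace of the torus representative is `1 + 2 cos θ`. -/
theorem trace_torusRep (θ : ℝ) :
    (Matrix.diagonal (![1, Complex.exp ((θ : ℂ) * Complex.I), Complex.exp (-((θ : ℂ) * Complex.I))] :
      Fin 3 → ℂ)).trace = ((1 + 2 * Real.cos θ : ℝ) : ℂ) := by
  rw [trace_diagonal, Fin.sum_univ_three]
  simp only [Matrix.cons_val_zero, Matrix.cons_val_one, Matrix.cons_val]
  rw [show -((θ : ℂ) * Complex.I) = (-(θ : ℂ)) * Complex.I by ring, ← Complex.cos_add_sin_I,
    ← Complex.cos_add_sin_I, Complex.cos_neg, Complex.sin_neg, ← Complex.ofReal_cos]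
  push_cast
  ring

/-- Its trace is real: `Im = 0`. -/
theorem im_trace_torusRep (θ : ℝ) :
    ((Matrix.diagonal (![1, Complex.exp ((θ : ℂ) * Complex.I), Complex.exp (-((θ : ℂ) * Complex.I))] :
      Fin 3 → ℂ)).trace).im = 0 := by
  rw [trace_torusRep, Complex.ofReal_im]

/-- Its trace has real part `1 + 2 cos θ`. -/
theorem re_trace_torusRep (θ : ℝ) :
    ((Matrix.diagonal (![1, Complex.exp ((θ : ℂ) * Complex.I), Complex.exp (-((θ : ℂ) * Complex.I))] :
      Fin 3 → ℂ)).trace).re = 1 + 2 * Real.cos θ := by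
  rw [trace_torusRep, Complex.ofReal_re]

/-- **Every real-trace element of `SU(3)` is conjugate to a torus representative**
`diag(1, e^{iθ}, e^{−iθ})` with `θ = arccos((Re tr U − 1)/2) ∈ [0, π]`. -/
theorem su3_exists_isConj_torusRep_of_im_trace_eq_zero (U : Matrix.specialUnitaryGroup (Fin 3) ℂ)
    (him : ((U : Matrix (Fin 3) (Fin 3) ℂ).trace).im = 0) :
    ∃ θ ∈ Set.Icc (0 : ℝ) Real.pi,
      IsConj U ⟨Matrix.diagonal (![1, Complex.exp ((θ : ℂ) * Complex.I),
        Complex.exp (-((θ : ℂ) * Complex.I))] : Fin 3 → ℂ), torusRep_mem θ⟩ := by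
  set t : ℝ := ((U : Matrix (Fin 3) (Fin 3) ℂ).trace).re with ht
  have hlo : -1 ≤ t := su3_neg_one_le_re_trace_of_im_eq_zero U him
  have hhi : t ≤ 3 := by
    have h := reTr_le U
    simp only [Fintype.card_fin, Nat.cast_ofNat] at h
    exact h
  refine ⟨Real.arccos ((t - 1) / 2), ⟨Real.arccos_nonneg _, Real.arccos_le_pi _⟩, ?_⟩
  rw [su3_isConj_iff_trace_eq]
  change (U : Matrix (Fin 3) (Fin 3) ℂ).trace = (Matrix.diagonal _).trace
  rw [trace_torusRep, Real.cos_arccos (by linarith) (by linarith)]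
  apply Complex.ext
  · rw [Complex.ofReal_re, ← ht]; ring
  · rw [Complex.ofReal_im, him]

/-- **The angle is unique in `[0, π]`**: `cos` is injective there. -/
theorem su3_torusRep_angle_unique (U : Matrix.specialUnitaryGroup (Fin 3) ℂ) {θ θ' : ℝ}
    (hθ : θ ∈ Set.Icc (0 : ℝ) Real.pi) (hθ' : θ' ∈ Set.Icc (0 : ℝ) Real.pi)
    (h : IsConj U ⟨Matrix.diagonal (![1, Complex.exp ((θ : ℂ) * Complex.I),
        Complex.exp (-((θ : ℂ) * Complex.I))] : Fin 3 → ℂ), torusRep_mem θ⟩)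
    (h' : IsConj U ⟨Matrix.diagonal (![1, Complex.exp ((θ' : ℂ) * Complex.I),
        Complex.exp (-((θ' : ℂ) * Complex.I))] : Fin 3 → ℂ), torusRep_mem θ'⟩) :
    θ = θ' := by
  rw [su3_isConj_iff_trace_eq] at h h'
  have e1 := h.symm.trans h'
  have e2 : ((1 + 2 * Real.cos θ : ℝ) : ℂ) = ((1 + 2 * Real.cos θ' : ℝ) : ℂ) := by
    rw [← trace_torusRep, ← trace_torusRep]
    exact e1
  have hcos : Real.cos θ = Real.cos θ' := by
    have := Complex.ofReal_injective e2
    linarith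
  exact Real.injOn_cos hθ hθ' hcos

/-- **The class of `D_θ`, `θ ∈ [0, π]`, in trace coordinates**: `U ∼ D_θ ⟺ Im tr U = 0 ∧
Re tr U = 1 + 2cos θ`. -/
theorem su3_isConj_torusRep_iff (U : Matrix.specialUnitaryGroup (Fin 3) ℂ) (θ : ℝ) :
    IsConj U ⟨Matrix.diagonal (![1, Complex.exp ((θ : ℂ) * Complex.I),
        Complex.exp (-((θ : ℂ) * Complex.I))] : Fin 3 → ℂ), torusRep_mem θ⟩ ↔
      ((U : Matrix (Fin 3) (Fin 3) ℂ).trace).im = 0 ∧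
        ((U : Matrix (Fin 3) (Fin 3) ℂ).trace).re = 1 + 2 * Real.cos θ := by
  rw [su3_isConj_iff_trace_eq]
  change (U : Matrix (Fin 3) (Fin 3) ℂ).trace = (Matrix.diagonal _).trace ↔ _
  rw [trace_torusRep, Complex.ext_iff, Complex.ofReal_re, Complex.ofReal_im, and_comm]

end SpecialUnitaryThree

end Summit.Ventures.LatticeQCDFlow.Scoring
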